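import Mathlib
import HarnessLib
import Summits.QuantumFields.YangMills.Theses.CoarseStiffnessTail
import Summits.QuantumFields.YangMills.Theorems.RevelationMartingaleMeanDeviationLogDepth
import Summits.QuantumFields.YangMills.Theorems.CoarseStiffnessTailCappedCoarseStiffnessLUnitPolyTailOfCount

/-!
# The BOUNDED-CUT-OFF SLICES of the crux `CoarseStiffnessTail.UnitPolyTailL` (stmt-QuantumFields-24027, S1_poly), volume-uniformly

Route `CoarseStiffnessTail` (LINE 20 «unit-poly-tail», ideator seat ym-r3-idea-2 g10, lens «nearmiss»).  The crux `UnitPolyTailL` asks for a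
power-law bound `Gibbs_K{θ_γ(0) ≤ |Ū^K(∂a) − 1|} ≤ C·γ^s` (`s > 3`) on the unit-scale plaquette tail of the `K`-fold block-averaged field,
with ONE set of constants for EVERY cut-off `K` (and every volume, every top plaquette).  THIS FILE proves, for EVERY `K₀`, the slice
`K ≤ K₀` with constants depending on `(L, K₀, b₀, p₀)` only — in particular uniformly in the volume — by composing two landed theorems
BY NAME: the width seat ym-ust-19936-w3's volume-uniform per-plaquette tail of the block-averaged field at every depth
(`RevelationMartingaleMeanDeviationLogDepth.perPlaquette_tail_allDepths`: [Balaban1985Averaging] Prop. 2 (52)–(54) LOCAL and `k`-uniform on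
the box below the corner + reflection positivity / chessboard at the finest level + the box count `243(7L+2)³L^{3j}`; exponent
`(9/1600)·p(g)²·L^{−3j}`) taken at the top depth `j = K`, and the absorption of the Gaussian factor into a power of the coupling
(`CoarseStiffnessTailUnitPolyTailOfCount.exp_neg_pFun_sq_le_pow`, rate `(9/1600)·L^{−3K₀}`, power `9`): the slice bound is `C·L^{8K₀}·γ⁴`.
KERNEL CERTIFICATE OF WHAT IS OPEN: the exponent of the elementary bound degrades like `L^{−3K}` («averaging is smoothing only for smooth
fields»), so no `K₀` gives the crux; the open content of `UnitPolyTailL` is exactly the UNIFORMITY IN THE CUT-OFF (Bałaban's induction,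
[Balaban1985UV3] (39)/(71)), registered as the organ stub of `Cruxes/HistoryTailL/Lines/unit_poly_tail.lean`.  This theorem is the
registered stub `stub_boundedCutoff` of that skeleton (v4) by name and signature, and the BC5 / tribunal-T3 witness of the route
(a decided truncation of the crux in a regime — fixed cut-off range — where the rung-R3 statement `YM3TorusSU2` says nothing).
No summit, no rung of LADDER-YM, no continuum limit and no mass gap is proved here.
-/

namespace Summit.QuantumFields.YangMills.Theorems.CoarseStiffnessTailUnitPolyTailLBoundedCutoff

open scoped BigOperators Topology Classical MeasureTheory ProbabilityTheory Matrix
open Filter Set Function TopologicalSpace MeasureTheory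
open Literature.MathematicalPhysics.QuantumFieldTheory
open Literature.MathematicalPhysics.QuantumFieldTheory.Balaban1983to89
open Literature.MathematicalPhysics.QuantumFieldTheory.Balaban1983to89.T3ContinuumYM3Torus
open Literature.MathematicalPhysics.QuantumFieldTheory.Balaban1983to89.T3UpperLiftSplit (scheme_β_eq)
open Summit.QuantumFields.YangMills.Theorems.RevelationMartingaleMeanDeviationLogDepth (perPlaquette_tail_allDepths)
open Summit.QuantumFields.YangMills.Theorems.CoarseStiffnessTailUnitPolyTailOfCount (exp_neg_pFun_sq_le_pow)

/-- **`UnitPolyTailL` ON EVERY BOUNDED CUT-OFF RANGE, VOLUME-UNIFORMLY** (= registered stub `stub_boundedCutoff`): for every `K₀`, `L` and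
every profile `b₀ > 0`, `p₀ > 2` there are `s = 4`, `C = C_L·L^{8K₀}` and `γ₁ ∈ (0, 1]` such that for every family `F` with `F.L = L`, every
`0 < γ ≤ γ₁`, every cut-off `K ≤ K₀` and every top plaquette `a`: `Gibbs_K{θ_γ(0) ≤ |Ū^K(∂a) − 1|} ≤ C·γ⁴`.
[cite: Balaban1985UV3, (7) p.257 and (71) p.273; Balaban1985Averaging, Prop. 2 (52)–(54) p.26] -/
theorem stub_boundedCutoff :
    ∀ (K₀ L : ℕ) (b₀ p₀ : ℝ), 0 < b₀ → 2 < p₀ → ∃ (s C γ₁ : ℝ), 3 < s ∧ 0 ≤ C ∧ 0 < γ₁ ∧ γ₁ ≤ 1 ∧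
        ∀ (F : T3Family) (γ : ℝ), F.L = L → 0 < γ → γ ≤ γ₁ → ∀ (K : ℕ), K ≤ K₀ → ∀ (a : Plaq (F.P K) K),
            (T3UnitScaleTilt.gibbsK F T3UnitLawDensityEML.ℰp γ K).real
                {U | T3UnitScaleTilt.θBal F.L γ b₀ p₀ 0 ≤ GaugeGroup.dist1 (GaugeField.plaqHol
                  (Averaging.iter (fun i => BlockAveraging.blockAvg (P := F.P K) (j := i) T3UnitLawDensityEML.ℰp) K U) a)} ≤
              C * γ ^ s := by
  intro K₀ L b₀ p₀ hb₀ hp₀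
  by_cases hL : 1 < L
  swap
  · exact ⟨4, 0, 1, by norm_num, le_rfl, one_pos, le_rfl, fun F γ hFL => absurd (hFL ▸ F.hL.2) hL⟩
  have hLr : (1 : ℝ) ≤ (L : ℝ) := by exact_mod_cast hL.le
  set Λ : ℝ := (L : ℝ) ^ K₀ with hΛ
  have hΛ1 : 1 ≤ Λ := one_le_pow₀ hLr
  have hΛ0 : 0 < Λ := lt_of_lt_of_le one_pos hΛ1
  obtain ⟨γa, C, hγa, hγa1, hC, hT⟩ := perPlaquette_tail_allDepths L hb₀ (by linarith : (0 : ℝ) < p₀)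
  have hc : (0 : ℝ) < 9 / 1600 / Λ ^ 3 := by positivity
  obtain ⟨γ₀, hγ₀, hγ₀1, hrate⟩ :=
    exp_neg_pFun_sq_le_pow (b₀ := b₀) (p₀ := p₀) (c := 9 / 1600 / Λ ^ 3) hb₀ hp₀.le hc 9
  refine ⟨4, C * Λ ^ 8, min γa γ₀, by norm_num, by positivity, lt_min hγa hγ₀, (min_le_left _ _).trans hγa1,
    fun F γ hFL hγ hγle K hK a => ?_⟩
  have hγa' : γ ≤ γa := hγle.trans (min_le_left _ _)
  have hγ₀' : γ ≤ γ₀ := hγle.trans (min_le_right _ _)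
  have h := hT F γ hFL hγ hγa' K K le_rfl a
  simp only [Nat.sub_self, pow_zero, mul_one, scheme_β_eq] at h
  -- `h : Gibbs_K{…} ≤ C * ((F.L)^K)^8 * (γ⁻¹)^5 * exp (−(9/1600·p(√γ)²/((F.L)^K)^3))`
  have hFL' : (F.L : ℝ) = L := by exact_mod_cast hFL
  rw [hFL'] at h
  have hLK : (L : ℝ) ^ K ≤ Λ := pow_le_pow_right₀ hLr hK
  have hLK0 : (0 : ℝ) < (L : ℝ) ^ K := by positivity
  have hLK8 : ((L : ℝ) ^ K) ^ 8 ≤ Λ ^ 8 := by gcongr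
  have hLK3 : ((L : ℝ) ^ K) ^ 3 ≤ Λ ^ 3 := by gcongr
  have hP : (0 : ℝ) ≤ 9 / 1600 * B10.pFun b₀ p₀ (Real.sqrt γ) ^ 2 := by positivity
  have hexp : Real.exp (-(9 / 1600 * B10.pFun b₀ p₀ (Real.sqrt γ) ^ 2 / ((L : ℝ) ^ K) ^ 3)) ≤
      Real.exp (-(9 / 1600 / Λ ^ 3 * B10.pFun b₀ p₀ (Real.sqrt γ) ^ 2)) := by
    apply Real.exp_le_exp.mpr
    have h1 : 9 / 1600 / Λ ^ 3 * B10.pFun b₀ p₀ (Real.sqrt γ) ^ 2 ≤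
        9 / 1600 * B10.pFun b₀ p₀ (Real.sqrt γ) ^ 2 / ((L : ℝ) ^ K) ^ 3 := by
      rw [div_mul_eq_mul_div]
      exact div_le_div_of_nonneg_left hP (by positivity) hLK3
    linarith
  have hr : Real.exp (-(9 / 1600 * B10.pFun b₀ p₀ (Real.sqrt γ) ^ 2 / ((L : ℝ) ^ K) ^ 3)) ≤ γ ^ 9 :=
    hexp.trans (hrate γ hγ hγ₀')
  have hγ5 : (0 : ℝ) ≤ (γ⁻¹) ^ 5 := pow_nonneg (inv_nonneg.2 hγ.le) 5
  refine h.trans ?_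
  calc C * ((L : ℝ) ^ K) ^ 8 * (γ⁻¹) ^ 5 * Real.exp (-(9 / 1600 * B10.pFun b₀ p₀ (Real.sqrt γ) ^ 2 / ((L : ℝ) ^ K) ^ 3))
      ≤ C * Λ ^ 8 * (γ⁻¹) ^ 5 * γ ^ 9 := by gcongr
    _ = C * Λ ^ 8 * γ ^ (4 : ℝ) := by
        have hγ0 : γ ≠ 0 := hγ.ne'
        rw [show (4 : ℝ) = ((4 : ℕ) : ℝ) by norm_num, Real.rpow_natCast, inv_pow, mul_assoc, mul_assoc, mul_assoc]
        congr 2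
        field_simp

/-- the slices in the crux's own quantifier shape: for every `K₀`, `UnitPolyTailL` restricted to the cut-offs `K ≤ K₀` holds (profile
`(max b₁ 1, max p₁ 3)` beyond any thresholds). [cite: Balaban1985UV3, (7) p.257 and (71) p.273] -/
theorem unitPolyTailL_slice_le (K₀ : ℕ) :
    ∀ (L : ℕ) (b₁ p₁ : ℝ), ∃ (b₀ p₀ : ℝ), b₁ ≤ b₀ ∧ p₁ ≤ p₀ ∧ 0 < b₀ ∧ 2 < p₀ ∧
      ∃ (s C γ₁ : ℝ), 3 < s ∧ 0 ≤ C ∧ 0 < γ₁ ∧ γ₁ ≤ 1 ∧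
        ∀ (F : T3Family) (γ : ℝ), F.L = L → 0 < γ → γ ≤ γ₁ → ∀ (K : ℕ), K ≤ K₀ → ∀ (a : Plaq (F.P K) K),
          (T3UnitScaleTilt.gibbsK F T3UnitLawDensityEML.ℰp γ K).real
              {U | T3UnitScaleTilt.θBal F.L γ b₀ p₀ 0 ≤ GaugeGroup.dist1 (GaugeField.plaqHol
                (Averaging.iter (fun i => BlockAveraging.blockAvg (P := F.P K) (j := i) T3UnitLawDensityEML.ℰp) K U) a)} ≤
            C * γ ^ s := by
  intro L b₁ p₁
  have hb₀ : (0 : ℝ) < max b₁ 1 := lt_of_lt_of_le one_pos (le_max_right _ _)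
  have hp₀ : (2 : ℝ) < max p₁ 3 := lt_of_lt_of_le (by norm_num) (le_max_right _ _)
  obtain ⟨s, C, γ₁, hs, hC, hγ₁, hγ₁1, h⟩ := stub_boundedCutoff K₀ L (max b₁ 1) (max p₁ 3) hb₀ hp₀
  exact ⟨max b₁ 1, max p₁ 3, le_max_left _ _, le_max_left _ _, hb₀, hp₀, s, C, γ₁, hs, hC, hγ₁, hγ₁1, h⟩

end Summit.QuantumFields.YangMills.Theorems.CoarseStiffnessTailUnitPolyTailLBoundedCutoff
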